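import Mathlib
import HarnessLib
import Literature.NumberTheory.Sieve.PrimeDivisorsOfPolynomials
import Literature.Computability.AlgebraicComplexity.DeterminantalIdealComplexityDescent
import Literature.Computability.AlgebraicComplexity.RealTauConjectureDepthFour

/-!
# ValiantsHypothesis — ArithmeticDescent II (prime notch), part 2/3: reduction of circuits with
# rational / algebraic constants modulo primes (kernel, route-independent)

Decomposition workshop `decomp-valiant`, lens 2, generation 13.  Two reduction theorems used by
`ArithmeticDescentPrimes.lean`:

* `exists_zmodCircuit_of_ratCircuit` — a circuit with constants in `ℚ` computing an integer polynomial
  `f` has, for EVERY prime `p` beyond the product of its denominators, a twin of the same size over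
  `𝔽_p` computing `f mod p` (restrict the constants to the local ring `ℤ_(p) ∩ ℚ`, `ratLocalSubring`,
  and reduce, `ratLocalToZMod`);
* `exists_zmodCircuit_of_numberFieldCircuit` / `exists_zmodCircuit_of_algCircuit` — a circuit with
  constants in a number field `K` (or in `ℚ̄`) has such a twin for INFINITELY MANY primes `p`: the
  split primes.  Proof: an integral primitive element `θ` of `K`, constants `r_c(θ)/b_c`
  (`Literature.NumberTheory.Sieve.exists_int_mul_eq_aeval`), Schur's theorem
  (`schur_exists_prime_dvd_eval`) for a prime `p > N + |∏ b_c|` with a root `a` of `minpoly ℤ θ` mod `p`,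
  the reduction `ℤ[θ] ≅ ℤ[X]/(minpoly) → 𝔽_p`, `θ ↦ a` (`minpoly.equivAdjoin`, `AdjoinRoot.lift`), and
  its extension to the localisation `ℤ[θ][1/B]` (`IsLocalization.Away.lift`), which embeds in `K`.

The gap between "every large prime" (rational constants) and "infinitely many primes" (algebraic
constants: only the primes of residue degree one) is the arithmetic content of the prime notch.
All sorry-free.
-/

noncomputable section
set_option linter.dupNamespace false

open Literature.Computability.AlgebraicComplexity Literature.NumberTheory.Sieve
open scoped IntermediateField

namespace Summit.ValiantsHypothesis.ValiantsHypothesis.Theorems.ArithmeticDescent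

/-! ### §4 Reduction of rational circuits modulo large primes -/

/-- The local ring `ℤ_(p) ∩ ℚ`: rationals whose reduced denominator is prime to `p`. [folklore] -/
def ratLocalSubring (p : ℕ) [Fact p.Prime] : Subring ℚ where
  carrier := {q : ℚ | ¬ p ∣ q.den}
  mul_mem' {a b} ha hb h := by
    rcases (Nat.Prime.dvd_mul Fact.out).1 (dvd_trans h (Rat.mul_den_dvd a b)) with h1 | h1
    exacts [ha h1, hb h1]
  one_mem' := by
    show ¬ p ∣ (1 : ℚ).den
    rw [Rat.den_ofNat]
    exact Nat.Prime.not_dvd_one Fact.out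
  add_mem' {a b} ha hb h := by
    rcases (Nat.Prime.dvd_mul Fact.out).1 (dvd_trans h (Rat.add_den_dvd a b)) with h1 | h1
    exacts [ha h1, hb h1]
  zero_mem' := by
    show ¬ p ∣ (0 : ℚ).den
    rw [Rat.den_ofNat]
    exact Nat.Prime.not_dvd_one Fact.out
  neg_mem' {a} ha := by
    show ¬ p ∣ (-a).den
    rw [Rat.neg_den]
    exact ha

/-- Reduction modulo `p` on `ℤ_(p) ∩ ℚ`, `a/b ↦ a · b⁻¹ (mod p)`: a ring homomorphism. [folklore] -/
def ratLocalToZMod (p : ℕ) [Fact p.Prime] : ratLocalSubring p →+* ZMod p where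
  toFun q := ((q : ℚ) : ZMod p)
  map_one' := by simp
  map_mul' a b := by
    have ha : ((a : ℚ).den : ZMod p) ≠ 0 := by rw [Ne, ZMod.natCast_eq_zero_iff]; exact a.2
    have hb : ((b : ℚ).den : ZMod p) ≠ 0 := by rw [Ne, ZMod.natCast_eq_zero_iff]; exact b.2
    rw [Subring.coe_mul]
    exact Rat.cast_mul_of_ne_zero ha hb
  map_zero' := by simp
  map_add' a b := by
    have ha : ((a : ℚ).den : ZMod p) ≠ 0 := by rw [Ne, ZMod.natCast_eq_zero_iff]; exact a.2
    have hb : ((b : ℚ).den : ZMod p) ≠ 0 := by rw [Ne, ZMod.natCast_eq_zero_iff]; exact b.2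
    rw [Subring.coe_add]
    exact Rat.cast_add_of_ne_zero ha hb

/-- **Reduction modulo large primes.**  A circuit with rational constants computing an integer
polynomial `f` has, for every prime `p` exceeding the product of the denominators of its constants, a
twin over `𝔽_p` of the same size (and fan-in) computing `f mod p`: restrict the constants to
`ℤ_(p) ∩ ℚ` and reduce. [cite: Burgisser2000, §4.1] -/
theorem exists_zmodCircuit_of_ratCircuit {σ : Type*} (Q : ArithCircuit ℚ σ) (f : MvPolynomial σ ℤ)
    (hQ : Q.Computes (MvPolynomial.map (Int.castRingHom ℚ) f)) :
    ∃ p₀ : ℕ, ∀ p, p₀ ≤ p → p.Prime →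
      ∃ Q' : ArithCircuit (ZMod p) σ, Q'.Computes (MvPolynomial.map (Int.castRingHom (ZMod p)) f) ∧
        Q'.size = Q.size ∧ (Q.IsFanInTwo → Q'.IsFanInTwo) := by
  classical
  set M : ℕ := (Q.consts.map Rat.den).prod with hM
  have hM0 : M ≠ 0 := by
    rw [hM]
    exact List.prod_ne_zero (by simp)
  refine ⟨M + 1, fun p hp hprime => ?_⟩
  haveI : Fact p.Prime := ⟨hprime⟩
  have hden : ∀ q ∈ Q.consts, ¬ p ∣ q.den := fun q hq hdvd => by
    have h1 : q.den ∣ M := hM ▸ List.dvd_prod (List.mem_map.2 ⟨q, hq, rfl⟩)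
    have h2 : q.den ≤ M := Nat.le_of_dvd (Nat.pos_of_ne_zero hM0) h1
    have h3 : p ≤ q.den := Nat.le_of_dvd q.den_pos hdvd
    omega
  let R := ratLocalSubring p
  let ρ : ℚ → R := fun q => if h : q ∈ R then ⟨q, h⟩ else 0
  let CR : ArithCircuit R σ := Q.mapConsts ρ
  have hback : CR.map R.subtype = Q :=
    ArithCircuit.map_mapConsts_eq_self ρ R.subtype Q fun c hc => by
      have hcR : c ∈ R := hden c hc
      simp [ρ, dif_pos hcR]
  have hCR : CR.eval = MvPolynomial.map (Int.castRingHom R) f := by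
    apply MvPolynomial.map_injective R.subtype Subtype.val_injective
    rw [← ArithCircuit.eval_map_apply, hback, MvPolynomial.map_map,
      Subsingleton.elim (R.subtype.comp (Int.castRingHom R)) (Int.castRingHom ℚ)]
    exact hQ
  refine ⟨CR.map (ratLocalToZMod p), ?_, ?_, fun h2 => (h2.mapConsts ρ).map _⟩
  · rw [ArithCircuit.Computes, ArithCircuit.eval_map_apply, hCR, MvPolynomial.map_map,
      Subsingleton.elim ((ratLocalToZMod p).comp (Int.castRingHom R)) (Int.castRingHom (ZMod p))]
  · rw [ArithCircuit.size_map, ArithCircuit.size_mapConsts]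

/-! ### §4b Reduction of algebraic circuits modulo split primes (Schur / Dedekind) -/

/-- **Reduction of a number-field circuit modulo split primes.**  A circuit with constants in a
finite extension `K/ℚ` computing an integer polynomial `f` has, for infinitely many primes `p`
(the primes `p ∤ B` modulo which the minimal polynomial of an integral primitive element `θ` of `K`
has a root, Schur/Dedekind), a twin over `𝔽_p` of the same size computing `f mod p`: write the
constants as `r_c(θ)/b_c`, localise `ℤ[θ]` at `B = ∏ b_c`, and map `θ ↦ a`, `1/B ↦ B⁻¹ (mod p)`. [folklore] -/
theorem exists_zmodCircuit_of_numberFieldCircuit {K : Type*} [Field K] [Algebra ℚ K]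
    [FiniteDimensional ℚ K] {σ : Type*} (Q : ArithCircuit K σ) (f : MvPolynomial σ ℤ)
    (hQ : Q.Computes (MvPolynomial.map (Int.castRingHom K) f)) (N : ℕ) :
    ∃ p : ℕ, p.Prime ∧ N < p ∧ ∃ Q' : ArithCircuit (ZMod p) σ,
      Q'.Computes (MvPolynomial.map (Int.castRingHom (ZMod p)) f) ∧ Q'.size = Q.size ∧
      (Q.IsFanInTwo → Q'.IsFanInTwo) := by
  classical
  haveI : CharZero K := charZero_of_injective_algebraMap (algebraMap ℚ K).injective
  -- an integral primitive element `θ`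
  obtain ⟨α, hα⟩ := Field.exists_primitive_element ℚ K
  obtain ⟨y, hy0, hθint⟩ :=
    ((IsFractionRing.isAlgebraic_iff ℤ ℚ K).mpr (Algebra.IsAlgebraic.isAlgebraic (R := ℚ) α)
      ).exists_integral_multiple
  set θ : K := y • α with hθdef
  have hθtop : ℚ⟮θ⟯ = ⊤ := by
    rw [eq_top_iff, ← hα, IntermediateField.adjoin_simple_le_iff]
    have hy : (y : K) ≠ 0 := by exact_mod_cast hy0
    have : α = (y : K)⁻¹ * θ := by
      rw [hθdef, zsmul_eq_mul, ← mul_assoc, inv_mul_cancel₀ hy, one_mul]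
    rw [this]
    exact mul_mem (inv_mem (intCast_mem _ y)) (IntermediateField.mem_adjoin_simple_self ℚ θ)
  -- every constant `c` is `r c (θ) / b c`
  choose b hb0 r hr using exists_int_mul_eq_aeval hθtop
  let S : Finset K := Q.consts.toFinset
  set B : ℤ := ∏ c ∈ S, b c with hB
  have hB0 : B ≠ 0 := Finset.prod_ne_zero_iff.mpr fun c _ => hb0 c
  let e : K → ℤ := fun c => ∏ c' ∈ S.erase c, b c'
  have hbe : ∀ c ∈ S, b c * e c = B := fun c hc => Finset.mul_prod_erase S b hc
  -- a Schur prime `p > N + |B|` with a root `a` of `minpoly ℤ θ` modulo `p`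
  obtain ⟨p, hp, hNp, a, hpa⟩ := schur_exists_prime_dvd_eval (minpoly ℤ θ)
    (minpoly.natDegree_pos hθint) (N + B.natAbs)
  refine ⟨p, hp, by omega, ?_⟩
  haveI := Fact.mk hp
  have hpB : ((B : ℤ) : ZMod p) ≠ 0 := fun h => by
    have hdvd : (p : ℤ) ∣ B := (ZMod.intCast_zmod_eq_zero_iff_dvd _ _).mp h
    have := Nat.le_of_dvd (Int.natAbs_pos.mpr hB0) (Int.ofNat_dvd_left.mp hdvd)
    omega
  have hroot : (minpoly ℤ θ).eval₂ (Int.castRingHom (ZMod p)) (a : ZMod p) = 0 := by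
    rw [Polynomial.eval₂_at_intCast, eq_intCast, ZMod.intCast_zmod_eq_zero_iff_dvd]
    exact hpa
  -- the order `A = ℤ[θ]`, its reduction `φ : A → 𝔽_p` (θ ↦ a), and the localisation `L = A[1/B]`
  let A : Subalgebra ℤ K := Algebra.adjoin ℤ ({θ} : Set K)
  let φ : A →+* ZMod p :=
    (AdjoinRoot.lift (Int.castRingHom (ZMod p)) (a : ZMod p) hroot).comp
      (minpoly.equivAdjoin hθint).symm.toRingEquiv.toRingHom
  let BA : A := algebraMap ℤ A B
  have hBAval : (BA : K) = (B : K) := by simp [BA]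
  have hBA0 : BA ≠ 0 := fun h => by
    have : (BA : K) = 0 := by rw [h]; rfl
    rw [hBAval] at this
    exact hB0 (by exact_mod_cast this)
  let L := Localization.Away BA
  have hBK : IsUnit (A.val.toRingHom BA) := by
    rw [isUnit_iff_ne_zero]
    change (BA : K) ≠ 0
    rw [hBAval]
    exact_mod_cast hB0
  have hφB : φ BA = (B : ZMod p) := by
    change φ (algebraMap ℤ A B) = _
    rw [Algebra.algebraMap_eq_smul_one, map_zsmul, map_one, zsmul_eq_mul, mul_one]
  have hBφ : IsUnit (φ BA) := by
    rw [isUnit_iff_ne_zero, hφB]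
    exact hpB
  let ι : L →+* K := IsLocalization.Away.lift BA hBK
  let φ' : L →+* ZMod p := IsLocalization.Away.lift BA hBφ
  have hιA : ∀ x : A, ι (algebraMap A L x) = (x : K) := fun x =>
    IsLocalization.Away.lift_eq BA hBK x
  -- `ι` is injective
  have hpow : Submonoid.powers BA ≤ nonZeroDivisors A :=
    powers_le_nonZeroDivisors_of_noZeroDivisors hBA0
  have hιinj : Function.Injective ι := by
    rw [IsLocalization.injective_iff_map_algebraMap_eq (Submonoid.powers BA)]
    intro x y
    rw [hιA, hιA]
    constructor
    · intro h
      rw [IsLocalization.injective L hpow h]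
    · intro h
      rw [Subtype.val_injective h]
  -- the inverse of `B` in `L`
  let iB : L := IsLocalization.Away.invSelf BA
  have hιiB : ι iB = (B : K)⁻¹ := by
    have h1 : algebraMap A L BA * iB = 1 := IsLocalization.Away.mul_invSelf BA
    have h2 := congrArg ι h1
    rw [map_mul, map_one, hιA, hBAval] at h2
    exact eq_inv_of_mul_eq_one_right h2
  -- the constants in `L`
  have hrA : ∀ c, Polynomial.aeval θ (r c) ∈ A := fun c => Polynomial.aeval_mem_adjoin_singleton ℤ θ
  let ρ : K → L := fun c => algebraMap A L (⟨Polynomial.aeval θ (r c), hrA c⟩ * algebraMap ℤ A (e c)) * iB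
  have hρ : ∀ c ∈ S, ι (ρ c) = c := by
    intro c hc
    have hbc : (b c : K) ≠ 0 := by exact_mod_cast hb0 c
    have hec0 : e c ≠ 0 := fun h => hB0 (by rw [← hbe c hc, h, mul_zero])
    have hec : (e c : K) ≠ 0 := by exact_mod_cast hec0
    have h1 : ι (ρ c) = (Polynomial.aeval θ (r c) * (e c : K)) * (B : K)⁻¹ := by
      simp [ρ, hιA, hιiB]
    have hBe : (B : K) = (b c : K) * (e c : K) := by rw [← hbe c hc]; push_cast; ring
    rw [h1, ← hr c, hBe, mul_inv, show (b c : K) * c * (e c : K) * ((↑(b c))⁻¹ * (↑(e c))⁻¹)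
      = ((b c : K) * (↑(b c))⁻¹) * ((e c : K) * (↑(e c))⁻¹) * c by ring,
      mul_inv_cancel₀ hbc, mul_inv_cancel₀ hec, one_mul, one_mul]
  -- the circuit over `L` and its reduction
  let CL : ArithCircuit L σ := Q.mapConsts ρ
  have hback : CL.map ι = Q :=
    ArithCircuit.map_mapConsts_eq_self ρ ι Q fun c hc => hρ c (List.mem_toFinset.mpr hc)
  have hCL : CL.eval = MvPolynomial.map (Int.castRingHom L) f := by
    apply MvPolynomial.map_injective ι hιinj
    rw [← ArithCircuit.eval_map_apply, hback, MvPolynomial.map_map,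
      Subsingleton.elim (ι.comp (Int.castRingHom L)) (Int.castRingHom K)]
    exact hQ
  refine ⟨CL.map φ', ?_, ?_, fun h2 => (h2.mapConsts ρ).map _⟩
  · rw [ArithCircuit.Computes, ArithCircuit.eval_map_apply, hCL, MvPolynomial.map_map,
      Subsingleton.elim (φ'.comp (Int.castRingHom L)) (Int.castRingHom (ZMod p))]
  · rw [ArithCircuit.size_map, ArithCircuit.size_mapConsts]

/-- The same for circuits over `ℚ̄`: the constants generate a finite extension of `ℚ`. [folklore] -/
theorem exists_zmodCircuit_of_algCircuit {σ : Type*} (Q : ArithCircuit (AlgebraicClosure ℚ) σ)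
    (f : MvPolynomial σ ℤ)
    (hQ : Q.Computes (MvPolynomial.map (Int.castRingHom (AlgebraicClosure ℚ)) f)) (N : ℕ) :
    ∃ p : ℕ, p.Prime ∧ N < p ∧ ∃ Q' : ArithCircuit (ZMod p) σ,
      Q'.Computes (MvPolynomial.map (Int.castRingHom (ZMod p)) f) ∧ Q'.size = Q.size ∧
      (Q.IsFanInTwo → Q'.IsFanInTwo) := by
  classical
  -- the two `ℚ`-algebra structures on `ℚ̄` (`DivisionRing.toRatAlgebra`, `AlgebraicClosure.instAlgebra`) agree
  haveI : Algebra.IsAlgebraic ℚ (AlgebraicClosure ℚ) := by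
    convert AlgebraicClosure.isAlgebraic ℚ <;> rfl
  let S : Finset (AlgebraicClosure ℚ) := Q.consts.toFinset
  let K : IntermediateField ℚ (AlgebraicClosure ℚ) :=
    IntermediateField.adjoin ℚ (S : Set (AlgebraicClosure ℚ))
  haveI : FiniteDimensional ℚ K :=
    IntermediateField.finiteDimensional_adjoin fun x _ =>
      (Algebra.IsAlgebraic.isAlgebraic (R := ℚ) x).isIntegral
  let ρ : AlgebraicClosure ℚ → K := fun c => if h : c ∈ K then ⟨c, h⟩ else 0
  let QK : ArithCircuit K σ := Q.mapConsts ρ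
  have hback : QK.map (algebraMap K (AlgebraicClosure ℚ)) = Q :=
    ArithCircuit.map_mapConsts_eq_self ρ _ Q fun c hc => by
      have hcK : c ∈ K :=
        IntermediateField.subset_adjoin ℚ _ (Finset.mem_coe.mpr (List.mem_toFinset.mpr hc))
      simp only [ρ, dif_pos hcK]
      rfl
  have hQK : QK.eval = MvPolynomial.map (Int.castRingHom K) f := by
    apply MvPolynomial.map_injective (algebraMap K (AlgebraicClosure ℚ))
      (algebraMap K (AlgebraicClosure ℚ)).injective
    rw [← ArithCircuit.eval_map_apply, hback, MvPolynomial.map_map,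
      Subsingleton.elim ((algebraMap K (AlgebraicClosure ℚ)).comp (Int.castRingHom K))
        (Int.castRingHom (AlgebraicClosure ℚ))]
    exact hQ
  obtain ⟨p, hp, hNp, Q', hQ'c, hQ's, hQ'2⟩ := exists_zmodCircuit_of_numberFieldCircuit QK f hQK N
  exact ⟨p, hp, hNp, Q', hQ'c, by rw [hQ's, ArithCircuit.size_mapConsts],
    fun h2 => hQ'2 (h2.mapConsts ρ)⟩

end Summit.ValiantsHypothesis.ValiantsHypothesis.Theorems.ArithmeticDescent

end
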